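import Literature.NumberTheory.EllipticCurves.CasselsTateSelmerKolyvaginValue
import Literature.NumberTheory.EllipticCurves.HeegnerPointsKolyvaginPrimaryLocalTrivialProofs
import Literature.NumberTheory.EllipticCurves.HeegnerPointsKolyvaginPrimaryLeavesProofs
import Literature.NumberTheory.EllipticCurves.HeegnerPointsKolyvaginPrimaryNoTorsionProofs
import HarnessLib

/-!
# The Cassels–Tate value on a Kolyvagin pair is the local term at `λ` (McCallum 1991, Prop. 4.7, for the descent)

Topic `NumberTheory/EllipticCurves`; namespace `Literature.NumberTheory.EllipticCurves`. Theorems only: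
**no definition and no named fact is introduced** (D-0026). Sibling of
`HeegnerPointsKolyvaginPrimaryLeavesProofs` (the descent data `KolyvaginDescent.HypothesesM` on
`V = H¹(K, E[p^M])` from the two Euler-system leaves) and of `CasselsTateSelmerKolyvaginValue`
(McCallum's Prop. 4.7 for a Kolyvagin pair, generic level).

In Kolyvagin's bound on the ORDER of `Ш(E/K)[p^∞]` (McCallum 1991, Thm. 5.4 / Cor. 5.6) the
Cassels–Tate pairing on `Ш(E/K)_{p^M} = S_{p^M}(E/K)/ℤx` is evaluated on pairs
`(p^j c_M(ℓm'), t)` — `c_M(n)` Kolyvagin's classes, `t ∈ S_{p^M}(E/K)` killed by `p^N` and vanishing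
at the primes of `m'` — and the value is the single local term at `λ ∣ ℓ` (Prop. 4.7), which
Lemma 5.3 then shows non-zero. This file proves the REDUCTION TO THE LOCAL TERM for the concrete
data of the descent at the level `M = 2M₀`, `m = p^{M₀}`:

* `KolyvaginDescent.forall_smul_eq_imp_eq_zero_of_surjective` — `E[p^{M₀}](K̄)` has no non-zero
  `Γ_K`-fixed point (`E(K)[p] = 0` for `K` imaginary quadratic and `ρ̄_{E,p}` onto, `p` odd:
  `torsionBy_eq_bot_of_isImaginaryQuadratic`, Galois descent for points);
* `KolyvaginDescent.exists_mem_primeFactors_natCast_mem` — a finite place containing a square-free `m'`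
  contains one of its prime factors;
* `KolyvaginDescent.ctLevelPairing_pullback_ne_zero_iff_localTerm_kolyvaginClass` — **the
  reduction**: for `ℓ` a Kolyvagin prime of level `p^{2M₀}` (`IsKolyvaginPrime ∧ FrobEqFrobInfty`),
  `n = ℓ m'` a square-free product of such primes, `z = p^j c(n) ∈ Sel` with `M₀ ≤ j`, `t ∈ Sel` with
  `p^N t = 0`, `N ≤ M₀`, vanishing in `H¹(K_v, E[p^{2M₀}])` at the places over the primes of `m'`, and
  the classes `c(·)` satisfying McCallum's Lemma 4.3 (Selmer off `n`): first-case data `D` with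
  `D.b₁ = p^{j-M₀} c(n)`, `ι_* D.b' = t` exist, and for each of them the pulled-back level-`p^{M₀}`
  Cassels–Tate pairing of `z` and `t` is non-zero **iff** `inv_λ((loc_λ D.b₁ - β_λ) ∪ β'_λ) ≠ 0`.

What remains of the value formula `hCTV` of `HeegnerPointsKolyvaginPrimaryOrderTelescopeProofs` is
therefore McCallum's Lemma 5.3 at `λ` for these data (a statement about `H¹(K_λ, E[p^{2M₀}])` alone),
plus the inputs of the tree's `ctLevelPairing` (`halt`, `hPT'`, `hH3`, `hfin`) and `Ш[p^{2M₀}] ⊆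
Ш[p^{M₀}]` (Kolyvagin's annihilation, for `ι`).

## References

* [McCallumLMS1991] W. G. McCallum, *Kolyvagin's work on Shafarevich–Tate groups* (1991), §4
  Lemma 4.3, Prop. 4.4, Prop. 4.7; §5 Lemma 5.3, Thm. 5.4 (proof).
* [GrossLMS1991] B. H. Gross, *Kolyvagin's work on modular elliptic curves* (1991), §3.
* [MilneADT2006] J. S. Milne, *Arithmetic Duality Theorems*, 2nd ed. (2006), Ch. I §6.
-/

noncomputable section

open scoped Classical
open scoped AddSubgroup

universe u

namespace Literature.NumberTheory.EllipticCurves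

namespace KolyvaginDescent

open CategoryTheory _root_.WeierstrassCurve Field Function NumberField IsDedekindDomain
open Literature.NumberTheory.GaloisRepresentations Literature.NumberTheory.GaloisCohomology
open Literature.NumberTheory.GaloisRepresentations.DiscreteGaloisModule (mu MuCarrier pairing)
open Literature.GroupTheory.FiniteAbelian
open scoped ContRepresentation

-- Cup products need `LocallyCompactSpace Γ`; as in the tree's cup-product files, the compactness of
-- absolute Galois groups is a local instance only.
attribute [local instance] absoluteGaloisGroup_compactSpace

-- `char K_v = 0` for the completions of a number field (local instance, no override).
attribute [local instance] charZero_placeCompletion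

variable (W : WeierstrassCurve ℚ) {K : Type u} [Field K] [NumberField K]

/-- **`E[p^k](K̄)` has no non-zero `Γ_K`-fixed point** for `K` imaginary quadratic, `p` odd and
`ρ̄_{E,p}` onto: a fixed point is `K`-rational (Galois descent, `exists_toGeomPoints_eq_of_forall_smul_eq`)
and `E(K)[p^k] = 0` (`torsionBy_eq_bot_of_isImaginaryQuadratic`, `torsionBy_pow_eq_bot`; Gross 1991,
Lemma 4.3 at `n = 1`). [cite: GrossLMS1991, §4 Lemma 4.3] -/
theorem forall_smul_eq_imp_eq_zero_of_surjective [W.IsElliptic] (hK : IsImaginaryQuadratic K)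
    {p : ℕ} (hp : p.Prime) (hp2 : p ≠ 2) (hρ : W.HasSurjectiveModNGaloisRep p) (k : ℕ)
    (Q : geomTorsion (W.baseChange K) ((p ^ k : ℕ) : ℤ))
    (hQ : ∀ σ : absoluteGaloisGroup K, σ • Q = Q) : Q = 0 := by
  have hbot := torsionBy_pow_eq_bot (torsionBy_eq_bot_of_isImaginaryQuadratic W K hK hp hp2 hρ) k
  have hQ' : ∀ σ : absoluteGaloisGroup K, σ • (Q : geomPoints (W.baseChange K)) = Q := fun σ => by
    rw [← AddSubgroup.torsionBy.coe_smul, hQ σ]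
  obtain ⟨R, hR⟩ := exists_toGeomPoints_eq_of_forall_smul_eq (W.baseChange K) hQ'
  have hRtor : R ∈ AddSubgroup.torsionBy (W.baseChange K).toAffine.Point ((p ^ k : ℕ) : ℤ) := by
    rw [AddSubgroup.torsionBy, Submodule.mem_toAddSubgroup, Submodule.mem_torsionBy_iff]
    apply toGeomPoints_injective (W.baseChange K)
    change toGeomPoints (W.baseChange K) ((((p ^ k : ℕ) : ℤ)) • R) = toGeomPoints (W.baseChange K) 0
    rw [map_zsmul, map_zero, hR]
    exact (mem_geomTorsion_iff (W.baseChange K) _ _).mp Q.2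
  rw [hbot] at hRtor
  have hR0 : R = 0 := hRtor
  apply Subtype.ext
  change (Q : geomPoints (W.baseChange K)) = 0
  rw [← hR, hR0, map_zero]

omit [NumberField K] in
/-- A finite place containing (the image of) a square-free natural number contains one of its prime
factors (`m' = ∏ q`, primality of the place). [folklore] -/
private theorem exists_mem_primeFactors_natCast_mem {m' : ℕ} (hm' : Squarefree m')
    {v : HeightOneSpectrum (𝓞 K)} (hv : (m' : 𝓞 K) ∈ v.asIdeal) :
    ∃ q ∈ m'.primeFactors, (q : 𝓞 K) ∈ v.asIdeal := by
  rw [← Nat.prod_primeFactors_of_squarefree hm', Nat.cast_prod] at hv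
  exact (Ideal.IsPrime.prod_mem_iff (hp := v.isPrime)).mp hv

section Value

variable [W.IsElliptic] {p M₀ : ℕ} [NeZero (p ^ M₀)]
variable (e : geomTorsion (W.baseChange K) ((p ^ M₀ * p ^ M₀ : ℕ) : ℤ) →
    geomTorsion (W.baseChange K) ((p ^ M₀ * p ^ M₀ : ℕ) : ℤ) → AlgebraicClosure K)
  (hμ : ∀ S T, e S T ^ (p ^ M₀ * p ^ M₀) = 1)
  (hadd₁ : ∀ S₁ S₂ T, e (S₁ + S₂) T = e S₁ T * e S₂ T)
  (hadd₂ : ∀ S T₁ T₂, e S (T₁ + T₂) = e S T₁ * e S T₂)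
  (hgal : ∀ (σ : absoluteGaloisGroup K) (S T : geomTorsion (W.baseChange K) ((p ^ M₀ * p ^ M₀ : ℕ) : ℤ)),
    σ • e S T = e (σ • S) (σ • T))
variable (inv : LocalInvariants K (p ^ M₀ * p ^ M₀))
-- `hPT'` is the reciprocity predicate `LocalInvariants.SumInvLocalizationEqZero` on `inv`, not a named fact.
variable (halt : ∀ T, e T T = 1) (hPT' : inv.SumInvLocalizationEqZero)
  (hH3 : ∀ c : galoisCohomology (mu K (p ^ M₀ * p ^ M₀)) 3,
    (∀ v : Place K, galoisCohomology.localization (mu K (p ^ M₀ * p ^ M₀)) v 3 c = 0) → c = 0)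
  (hfin : ∀ D : GeneralCaseData (W.baseChange K) (p ^ M₀) e hμ hadd₁ hadd₂ hgal,
    ∃ S : Finset (Place K), ∀ v ∉ S, D.localTerm inv v = 0)
variable (ι : selmerGroup (W.baseChange K) ((p ^ M₀ * p ^ M₀ : ℕ) : ℤ) →+ ((W.baseChange K).sha)[p ^ M₀])
  (hι : ∀ z, shaTorsionVal (W.baseChange K) (p ^ M₀) (ι z) =
    torsionH1ToH1 (W.baseChange K) ((p ^ M₀ * p ^ M₀ : ℕ) : ℤ) z)

include halt hPT' hι in
/-- **The Cassels–Tate value on a Kolyvagin pair is the local term at `λ`** (McCallum 1991,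
Prop. 4.7 as used in the proof of Thm. 5.4, p. 288, for the descent data at level `M = 2M₀`,
`m = p^{M₀}`). Setting: `E = W/ℚ` elliptic, `K` imaginary quadratic, `y_K` a Heegner point of level
`N` (good reduction at the Kolyvagin primes), `p` odd with `ρ̄_{E,p}` onto; classes
`c(n) ∈ H¹(K, E[p^{2M₀}])` satisfying McCallum's Lemma 4.3 at the square-free products of Kolyvagin
primes of level `p^{2M₀}` (leaf (A) of `HeegnerPointsKolyvaginPrimaryLeavesProofs`); `ℓ` such a prime,
`n = ℓ m'` such a product (`ℓ ∤ m'` is not needed here); `z = p^j c(n) ∈ Sel` with `M₀ ≤ j`; `t ∈ Sel` with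
`p^N t = 0`, `N ≤ M₀`, and `t_v = 0` in `H¹(K_v, E[p^{2M₀}])` at every place `v` over a prime of `m'`.
Then first-case data `D` (level `p^{M₀}`, auxiliary level `p^{2M₀}`) with `D.b₁ = p^{j-M₀} c(n)` and
`ι_* D.b' = t` exist, and for every such `D` the pulled-back level-`p^{M₀}` Cassels–Tate pairing
`B(ι z, ι t)` is non-zero iff the local term `inv_λ((loc_λ D.b₁ - β_λ) ∪ β'_λ)` at `λ = (ℓ)` is
non-zero. All other local terms vanish: at the complex place and at the finite `v ∤ n` because
`c(n)` is Selmer there (Lemma 4.3), at `v ∣ m'` because `t_v = 0` and `Γ_{K_v}` fixes `E[p^{2M₀}]`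
(`absGaloisRestrict_smul_geomTorsion_eq_of_kolyvaginPrime`).
[cite: McCallumLMS1991, §4 Lemma 4.3, Prop. 4.7; §5 Thm. 5.4 (proof)] [cite: GrossLMS1991, §3 (3.1)–(3.2)] -/
theorem ctLevelPairing_pullback_ne_zero_iff_localTerm_kolyvaginClass
    (hK : IsImaginaryQuadratic K) {N : ℕ} [NeZero N] {P : (W.baseChange K).toAffine.Point}
    (hP : IsHeegnerPoint N W K P) (hp : p.Prime) (hp2 : p ≠ 2) (hρ : W.HasSurjectiveModNGaloisRep p)
    (cl : ℕ → galH1Torsion (W.baseChange K) ((p ^ M₀ * p ^ M₀ : ℕ) : ℤ))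
    (hcl : ∀ n : ℕ, Squarefree n →
      (∀ q ∈ n.primeFactors, IsKolyvaginPrime N W K p q ∧ FrobEqFrobInfty W K (p ^ M₀ * p ^ M₀) q) →
      ∀ v : HeightOneSpectrum (𝓞 K), (n : 𝓞 K) ∉ v.asIdeal →
        cl n ∈ selmerLocalKer (W.baseChange K) (v.adicCompletion K) ((p ^ M₀ * p ^ M₀ : ℕ) : ℤ))
    {ℓ m' : ℕ} (hℓ : IsKolyvaginPrime N W K p ℓ ∧ FrobEqFrobInfty W K (p ^ M₀ * p ^ M₀) ℓ)
    (hsupp : KolSupp (fun q => IsKolyvaginPrime N W K p q ∧ FrobEqFrobInfty W K (p ^ M₀ * p ^ M₀) q)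
      (ℓ * m'))
    {j N' : ℕ} (hj : M₀ ≤ j) (hN' : N' ≤ M₀)
    {t : galH1Torsion (W.baseChange K) ((p ^ M₀ * p ^ M₀ : ℕ) : ℤ)}
    (ht : t ∈ selmerGroup (W.baseChange K) ((p ^ M₀ * p ^ M₀ : ℕ) : ℤ))
    (hz : ((p : ℤ) ^ j) • cl (ℓ * m') ∈ selmerGroup (W.baseChange K) ((p ^ M₀ * p ^ M₀ : ℕ) : ℤ))
    (hpt : ((p : ℤ) ^ N') • t = 0)
    (hAq : ∀ q ∈ m'.primeFactors, ∀ v : HeightOneSpectrum (𝓞 K), (q : 𝓞 K) ∈ v.asIdeal →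
      t ∈ (W.baseChange K).torsionLocalKer (v.adicCompletion K) ((p ^ M₀ * p ^ M₀ : ℕ) : ℤ)) :
    (∃ D : FirstCaseData (W.baseChange K) (p ^ M₀), D.b₁ = ((p : ℤ) ^ (j - M₀)) • cl (ℓ * m') ∧
      galoisCohomology.map (inclKD (W.baseChange K) (p ^ M₀) (p ^ M₀)) 1 D.b' = t) ∧
    ∀ D : FirstCaseData (W.baseChange K) (p ^ M₀), D.b₁ = ((p : ℤ) ^ (j - M₀)) • cl (ℓ * m') →
      galoisCohomology.map (inclKD (W.baseChange K) (p ^ M₀) (p ^ M₀)) 1 D.b' = t →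
      (ctLevelPairing (W.baseChange K) (p ^ M₀) e hμ hadd₁ hadd₂ hgal inv halt hPT' hH3 hfin
          (ι ⟨_, hz⟩) (ι ⟨t, ht⟩) ≠ 0 ↔
        D.localTerm e hμ hadd₁ hadd₂ hgal inv (Sum.inr hℓ.1.place) ≠ 0) := by
  have hk0 : p ^ M₀ * p ^ M₀ ≠ 0 := mul_ne_zero (NeZero.ne _) (NeZero.ne _)
  -- `z = p^{M₀} • (p^{j-M₀} • c(n))`
  have hz' : ((⟨_, hz⟩ : selmerGroup (W.baseChange K) ((p ^ M₀ * p ^ M₀ : ℕ) : ℤ)) :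
      galH1Torsion (W.baseChange K) ((p ^ M₀ * p ^ M₀ : ℕ) : ℤ)) =
        ((p ^ M₀ : ℕ) : ℤ) • ((p : ℤ) ^ (j - M₀)) • cl (ℓ * m') := by
    have h1 : ((p ^ M₀ : ℕ) : ℤ) * (p : ℤ) ^ (j - M₀) = (p : ℤ) ^ j := by
      rw [Nat.cast_pow, ← pow_add, Nat.add_sub_cancel' hj]
    change ((p : ℤ) ^ j) • cl (ℓ * m') = _
    rw [← mul_smul, h1]
  -- `p^{M₀} • t = 0`
  have hmt : ((p ^ M₀ : ℕ) : ℤ) • ((⟨t, ht⟩ : selmerGroup (W.baseChange K) ((p ^ M₀ * p ^ M₀ : ℕ) : ℤ)) :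
      galH1Torsion (W.baseChange K) ((p ^ M₀ * p ^ M₀ : ℕ) : ℤ)) = 0 := by
    have h2 : ((p ^ M₀ : ℕ) : ℤ) = (p : ℤ) ^ (M₀ - N') * (p : ℤ) ^ N' := by
      rw [Nat.cast_pow, ← pow_add, Nat.sub_add_cancel hN']
    change ((p ^ M₀ : ℕ) : ℤ) • t = 0
    rw [h2, mul_smul, hpt, zsmul_zero]
  -- `E[p^{M₀}]` has no non-zero `Γ_K`-fixed point
  have hfix : ∀ Q : geomTorsion (W.baseChange K) ((p ^ M₀ : ℕ) : ℤ),
      (∀ σ : absoluteGaloisGroup K, σ • Q = Q) → Q = 0 :=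
    fun Q hQ => forall_smul_eq_imp_eq_zero_of_surjective W hK hp hp2 hρ M₀ Q hQ
  refine ⟨exists_firstCaseData_kolyvagin (W := W.baseChange K) (m := p ^ M₀) ⟨_, hz⟩ ⟨t, ht⟩
      (cl (ℓ * m')) ((p : ℤ) ^ (j - M₀)) hz' hfix hmt, fun D hD₁ hDt => ?_⟩
  -- the places `T` over the primes of `m'`
  have hm'sq : Squarefree m' := hsupp.1.squarefree_of_dvd (dvd_mul_left m' ℓ)
  refine ctLevelPairing_pullback_ne_zero_iff_localTerm_kolyvagin e hμ hadd₁ hadd₂ hgal inv halt hPT'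
    hH3 hfin ι hι _ _ (cl (ℓ * m')) ((p : ℤ) ^ (j - M₀)) hz' hℓ.1.place
    {v | ∃ q ∈ m'.primeFactors, (q : 𝓞 K) ∈ v.asIdeal} ?_ ?_ ?_ D hD₁ hDt
  · -- `c(n)` is Selmer off `λ` and the places of `m'` (Lemma 4.3; the complex place)
    intro v hv0 hvT
    rcases v with w | v
    · haveI : IsAlgClosed w.Completion :=
        isAlgClosed_of_ringEquiv (InfinitePlace.Completion.ringEquivComplexOfIsComplex
          (hK.2.isComplex w)).symm
      rw [selmerLocalKer_completion_inl, WeierstrassCurve.selmerLocalKer_eq_top_of_isAlgClosed]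
      trivial
    · rw [selmerLocalKer_completion_inr]
      refine hcl (ℓ * m') hsupp.1 hsupp.2 v ?_
      intro hmem
      obtain h | h := natCast_mul_mem_asIdeal hmem
      · exact hv0 (by rw [hℓ.1.mem_iff.mp h])
      · obtain ⟨q, hq, hqv⟩ := exists_mem_primeFactors_natCast_mem hm'sq h
        exact hvT v ⟨q, hq, hqv⟩ rfl
  · -- `t_v = 0` at the places over the primes of `m'`
    rintro v ⟨q, hq, hqv⟩
    haveI : CharZero (v.adicCompletion K) :=
      charZero_of_injective_algebraMap (algebraMap K (v.adicCompletion K)).injective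
    exact (mem_torsionLocalKer_iff_res_eq_zero (W.baseChange K) (v.adicCompletion K) hk0 t).mp
      (hAq q hq v hqv)
  · -- `Γ_{K_v}` fixes `E[p^{2M₀}]` at the (Kolyvagin) places of `m'`
    rintro v ⟨q, hq, hqv⟩ g Q
    have hqn : q ∈ (ℓ * m').primeFactors :=
      Nat.primeFactors_mono (dvd_mul_left m' ℓ) hsupp.1.ne_zero hq
    have hKol := hsupp.2 q hqn
    have hv : v = hKol.1.place := hKol.1.mem_iff.mp hqv
    subst hv
    haveI : NeZero (p ^ M₀ * p ^ M₀) := ⟨hk0⟩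
    have hpv : ((p : ℕ) : 𝓞 K) ∉ hKol.1.place.asIdeal :=
      not_natCast_mem_of_prime_ne hKol.1.prime hp hKol.1.2.2.2.1 hKol.1.place hKol.1.mem_place
    have hqlam : ((((p ^ M₀ * p ^ M₀ : ℕ) : ℤ)) : 𝓞 K) ∉ hKol.1.place.asIdeal := by
      have h3 : ((((p ^ M₀ * p ^ M₀ : ℕ) : ℤ)) : 𝓞 K) = ((p : ℕ) : 𝓞 K) ^ (M₀ + M₀) := by
        push_cast
        ring
      rw [h3]
      exact fun h => hpv (hKol.1.place.isPrime.mem_of_pow_mem _ h)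
    exact absGaloisRestrict_smul_geomTorsion_eq_of_kolyvaginPrime W hK hKol.1 hKol.2
      (hKol.1.not_mem_badPlaces hP) hqlam g Q

end Value

end KolyvaginDescent

end Literature.NumberTheory.EllipticCurves

end
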